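import Literature.MathematicalPhysics.QuantumFieldTheory.Balaban1983to89.B8Thm2TorusOfProp6DeltaASide
import Literature.MathematicalPhysics.QuantumFieldTheory.Balaban1983to89.B9B8KnitTorusSocketCataloguedFour

/-!
# `Balaban1983to89.B8Thm2TorusOfProp6DeltaAFour` — sub-row G-B8-T2S, file G6b: [Balaban1985RegularSpaces] THEOREM 2 ON THE TORUS `T_η` FOR `SU(N)`, (3.35)
# DROPPED BY PROPOSITION 6, DISPLAYED MODULO THE FOUR Δ_a-SIDE MEMBERS OF [B9] §3 AT BIG BLOCKS `M_h = L^{a′}` — G3 ∕ G5 re-issued on F10′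
# `B9B8KnitTorusSocketCataloguedFour` (members (5) `IsUnit Δ′_a`, (6) `IsUnit (Q′G′²Q′*)` discharged; the big-block exponent `a′` the consumer's)

statement-level skeleton of published theorems with citation tags; proofs where landed; nothing here is a claim about the
Yang–Mills mass gap

T. Bałaban, *Spaces of regular gauge field configurations on a lattice and gauge fixing conditions*, Commun. Math. Phys. **99** (1985) 75–102
[`Balaban1985RegularSpaces`, "[B8]"]: Thm 2 p. 83, (1.33)–(1.39) pp. 82–83, p. 82 («eventually we will drop it out»), Prop. 6 (1.135)–(1.138) p. 99, p. 77
(«Ω_j = T_η for j = 0,1,…,l, l ≤ k»), p. 76 («G = SU(N)»), Prop. 3 (1.58)–(1.60) pp. 86–87.  T. Bałaban, *Propagators for lattice gauge theories in a background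
field*, Commun. Math. Phys. **99** (1985) 389–434 [`Balaban1985BackgroundPropagators`, "[B9]"]: (3.35)–(3.37) p. 396, Thm 3.1 p. 397, Thm 3.2 p. 398, Thm 3.3
p. 399, Thm 3.4 p. 400, (3.69) p. 404, p. 408 l. 30–34 («In [4] we have proved all theorems under the assumption that R, M are sufficiently large. We take these
numbers as powers of L»), Thm 3.7 p. 409, Thm 3.11 p. 416 («for M sufficiently large and α₀ sufficiently small … This is obvious for the first three operators»).
[4] = [`Balaban1984PropagatorsII`] (2.1)–(2.4) p. 224, Lemma 2.1 pp. 233–234.  [`Balaban1985Averaging`] (4) p. 18, Prop. 2 p. 26, (52)–(54) pp. 26–27.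
[`Balaban1985UV3`] (1)–(3) p. 256.

WHY.  G5 `B8Thm2TorusOfProp6DeltaASide` displays, as the ONLY antecedent of [B8] Thm 2 on the torus (existence half, `SU(N)`, `Reg := ⊤`), F10's SIX-member
Δ_a-side binder at EVERY shape-member `i : KIdx d ℓ hd hL 1 1` of a constant level — whatever its big-block parameter `i.Mh`.  But [B9]'s Theorems 3.1–3.11
are printed «for M sufficiently large», `M` a power of `L` (p. 408 l. 30–34; Thm 3.7 p. 409, Thm 3.9 p. 413, Thm 3.11 p. 416): a faithful supplier of the
Δ_a-side members serves members with LARGE big blocks only, so the binder must NAME `M_h`; and two of the six members — (5) `IsUnit Δ′_a(U)`, (6)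
`IsUnit (Q′G′²Q′*)(U)` — are theorems of the tree (Thm 3.11's «obvious for the first three operators»: `B9Thm311PositivityKnitLetter.isUnit_deltaPrimeAY_parKnitY`,
`B9B8KnitLetterProjectionC.isUnit_XY_parKnitY`, legs `U(N)`-valued by [B7] Prop. 2).  F10′ `B9B8KnitTorusSocketCataloguedFour.sockB9P3Per_torus_allLevels_catalogued_four`
re-issues the (B)-arrow socket from the FOUR members (1)–(4) at the members with `i.Mh = L^a`; THIS FILE re-issues G3 §1 and G5 §2–§3 on it, with one more
input `a′` (`L^{a′} ≥ 8`) — the big-block exponent at which the consumer can serve (1)–(4) — and the located volume threshold `k₀ := max k₀ (a′ + 3)`; §4 records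
that every requested size `M₁` is met by some `a′` (`∃ a′, 8 ≤ L^{a′} ∧ M₁ ≤ L^{a′}`).

WHAT IS PROVED (kernel; 0 `def`, 0 `… : Prop` fact, 0 sorry; standard axioms).  Every endpoint comes in TWO currencies: print's `Thm2TorusAt L k P₀ η 0 B₁ B₂ c₁ len
SU(N) ⊤` (BOTH halves of Thm 2: existence AND uniqueness of the `P₀`-periodic `SU(N)`-valued gauge — what pub-ymgap's period reduction
`BalabanUVNodesN16Thm2TorusOfCover.thm2TorusAt_of_dvd` reads for the small-volume members, LF-2VOL) and the Setup form `Thm2SetupSUAt` the 19200 dictionary reads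
(`B8Thm2SetupTorus.thm2SetupSUAt_of_thm2TorusAt`).
* §0 ★★★★ `thm2TorusAtSU_ofCubeData_catalogued_exists` — G2 §2 `thm2SetupSUAt_ofCubeData_catalogued_exists` (band `b₀ = b₁ = 1`) in the `Thm2TorusAt` currency
  (same proof, the last conversion dropped).
* §1′ ★★★★★ `thm2TorusAtSU_ofCubeData_deltaAFour_exists` ∕ §1 ★★★★★ `thm2SetupSUAt_ofCubeData_deltaAFour_exists` — G3 §1 with the input `a′` and the Δ_a-side
  binder := F10′'s FOUR members at `i.Mh = L^{a′}` (`K′ = k`), in the two currencies.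
* §2′ ★★★★★ `thm2TorusAtSU_ofProp6_deltaAFour_exists` ∕ §2 ★★★★★ `thm2SetupSUAt_ofProp6_deltaAFour_exists` — G5 §2 likewise ((3.35) dropped by Prop. 6: G5 §1
  `reg335Cube_ball_of_prop6At` + G4 BY NAME), in the two currencies.
* §3 ★★★★★ `hThm2_of_prop6_deltaAFour` — G5 §3 likewise: the 19200 `hThm2` binder form (`d + 1 = 3`, `N = 2`, `T3Family`), for the families with `k₀ ≤ F.m + n`.
* §4 ★ `exists_exponent_ge` — `∀ M₁, ∃ a′, 8 ≤ L^{a′} ∧ M₁ ≤ L^{a′}` (`L ≥ 2`).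

HONEST SCOPE ∕ NOT CLAIMED.  Composition BY NAME (G2 via G3's road, F10′, r05's `b9Arrow_of_sockB9P3Per`, G4, G5 §1, pub-ymgap's Prop. 6 theorem, A13's
`P_eq_PV`) with threshold bookkeeping; NO estimate of [B8] ∕ [B9] ∕ [4] is proved IN THIS FILE.  What REMAINS displayed: the FOUR Δ_a-side members — `Δ_a(U)`
invertible and the three weighted bounds of `G_a(U) = Δ_a(U)⁻¹` at a uniform `B₀` ([B9] (3.69) p. 404 ∕ Thms 3.3–3.4-type content at def-Y's letters
`parKnitY i, parBY i, GpY i (parKnitY i)`) — at every shape-member of constant level `1 ≤ m′ ≤ k` WITH `i.Mh = L^{a′}` and every `U(N)`-valued `P₀`-periodic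
background `U₀ ∈ 𝔄_{m′}(T_η, α₀)`, `α₀ ≤ a_T` (cell gaps G-B9-02 ff., the G-B9-LETTERS road).  Located volume threshold `k + max k₀ (a′+3) ≤ m + K`; `SU(N)`,
`N ≤ 25`; sup-entries only (`β₀ = 0`); existence half of Thm 2 only (as the 19200 consumer reads); DESIGN constants; count-neutral; no summit ∕ sub-problem
statement is proved; NOT a node discharge; `stub_PV3A` NOT discharged; nothing continuum ∕ ℝ⁴ ∕ OS ∕ mass-gap ∕ Clay — the Yang–Mills mass gap is NOT
proved by any of this.  No `sorry`, no `axiom`, no `def`, no `instance`, no `notation`.  NEW file; nothing landed is modified (G3 ∕ G5 stay as the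
six-member twins).  Cell `lit-balaban`, seat `lit-balaban-t2s-1` gen 9, 2026-08-28; `--supports stmt-QuantumFields-19200`.
-/

noncomputable section

open scoped BigOperators

namespace Literature.MathematicalPhysics.QuantumFieldTheory.Balaban1983to89.B8Thm2TorusOfProp6DeltaAFour

open Node00 B6KLevelCensusIndexV1 B9Eq39Adjoint
open B7Prop1Explicit renaming Site → LSite
open B7Prop1Explicit (e)
open B7Prop2Explicit (unitaryUnits C0 c2')
open B4PartitionUnity22 (thetaProf D1)
open B6Cover236MultiLevelBlocks (cubes)
open B6GlobalChartV1 (PV boxEquiv)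
open B9BackgroundsKLevelV1 (shiftsV1)
open B9Eq360DeltaPrimeAY (AfldY)
open B9GeoNormsKLevelV1 (geo9K)
open B9Cor36CubeCutoffs (SC NearC one_le_SC nine_le_SC)
open B9CubeSequence408 (ctrC)
open B8Ineq132 (InAk)
open B8LeafModelZd (ZdIdx)
open B8Thm2TorusLettersPerOfKnit (bgY)
open B9B8AveragingJunction (parKnitY)
open B9SupplySockB9P3ZdLetters (OpsZd)
open B9Eq316AveragingTransposeZd (qQ betaTau alphaQ)
open B7Prop2SpecialUnitary (specialUnitaryUnits specialUnitaryUnits_le_unitaryUnits)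
open B8Thm2TorusAt (Thm2TorusAt)
open B8Thm2SetupTorus (Thm2SetupSUAt thm2SetupSUAt_of_thm2TorusAt pow_dvd_period)
open B6Ineq2142KLevelV1 (β)
open B9CubeGeometryInputs (RM1)
open B8Thm2TorusKnitEstimatesOfMajorants (B9P3PerAt)
open B8Thm2TorusMemberCatalogueThresholds (exists_catalogueF16)
open B8Thm2TorusKnitOfCubeDataCatalogued (thm2TorusAt_specialUnitary_ofCubeData')
open B9B8KnitTorusSocketCataloguedFour (sockB9P3Per_torus_allLevels_catalogued_four)
open B8Eq159TorusPerOfSockB9P3Per (b9Arrow_of_sockB9P3Per)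
open B9Eq335CubeDatumOfReg335Zd (cubeDatum_of_reg335Zd)
open B8Eq133Hypotheses (shiftT byDir Reg335Zd)
open B9Eq335RegularityClasses (Reg335Cube)
open B8Thm2TorusMember (TorusMember torusIdx)
open B9SupplySockB9P3ZdAt (Prop6At)
open B9SupplySockB9P3ZdFrame (memZd bgZd ιCfgZd)
open B8Prop6Reg335ZdAllTorus (prop6At_bgZd_allTorus_holds)
open B8Thm2TorusOfProp6DeltaASide (reg335Cube_ball_of_prop6At)
open B8Thm2T3FamilyBinder (P_eq_PV)
open T3ContinuumYM3Torus (T3Family)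
open T3SectALandauChart (eta eta_pos)
open T4TermwiseTorus (IsPeriodic)
open LatticeNorms (scaleLen)
open scoped Matrix Matrix.Norms.L2Operator

variable {d ℓ : ℕ} {hd : 1 ≤ d + 1} {hL : Odd (ℓ + 1) ∧ 1 < ℓ + 1}

/-! ## §0 ★★★★ G2 §2 in the `Thm2TorusAt` currency (band `b₀ = b₁ = 1`) -/

section Setup

variable {N : ℕ} [NeZero N]
variable [instF : ∀ i : KIdx d ℓ hd hL 1 1, Fintype (geo9K i).Site] [instD : ∀ i : KIdx d ℓ hd hL 1 1, DecidableEq (geo9K i).Site]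

/-- ★★★★ **G2 §2 IN PRINT's CURRENCY**: `B8Thm2TorusKnitOfCubeDataCatalogued.thm2SetupSUAt_ofCubeData_catalogued_exists` at band `b₀ = b₁ = 1` with the conclusion
`Thm2TorusAt L k P₀ η 0 B₁ B₂ c₁ len SU(N) ⊤` — BOTH halves of [B8] Thm 2 (existence AND uniqueness of the `P₀`-periodic `SU(N)`-valued gauge `u` with (1.29) and
(1.36)–(1.39)) at the torus `PV d ℓ m K` (`P₀ = 2L^{m+K}`), from (α) the per-cube (3.35) data at the catalogue's members and the (B)-lines `B9P3PerAt`; same proof as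
G2 §2 (F16′ §1 `thm2TorusAt_specialUnitary_ofCubeData'` + G1 `exists_catalogueF16`), the final `thm2SetupSUAt_of_thm2TorusAt` dropped.  HONEST SCOPE: (α) and the
(B)-lines displayed; `stub_PV3A` NOT discharged; the Yang–Mills mass gap is NOT proved.
[cite: Balaban1985RegularSpaces, Thm 2 p.83, (1.29) p.81, (1.33)–(1.39) pp.82–83, p.77 («Ω_j = T_η»), p.76 («G = SU(N)»), (1.58)–(1.60) pp.86–87; Balaban1985BackgroundPropagators, (3.35)–(3.37) p.396, Thm 3.7 p.409, p.410 l.1–4; Balaban1984PropagatorsII, (2.1)–(2.4) p.224, Lemma 2.1 pp.233–234] -/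
theorem thm2TorusAtSU_ofCubeData_catalogued_exists (hN : N ≤ 25) (hd2 : 2 ≤ d + 1) (hℓ : 4 ≤ ℓ)
    {B₀ B₀β cB9 βH : ℝ} {len : LSite (d + 1) → ℝ}
    (hB₀ : 0 < B₀) (hB : 2 ≤ 5 * ((d + 1 : ℕ) : ℝ) * ((ℓ + 1 : ℕ) : ℝ) * B₀) (hcB9 : 0 < cB9)
    {ι : Type} [Fintype ι] [DecidableEq ι] (b : Module.Basis ι ℝ (Matrix (Fin N) (Fin N) ℂ)) {M₂ : ℝ} (hM₂ : 0 ≤ M₂)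
    (hrepr : ∀ (v : Matrix (Fin N) (Fin N) ℂ) (j : ι), |b.repr v j| ≤ M₂ * ‖v‖) (Rr : ℝ) (Hp : Prop) :
    letI : CStarAlgebra (Matrix (Fin N) (Fin N) ℂ) := {}
    ∃ a₁ : ℝ, 0 < a₁ ∧ ∃ a₀' : ℝ, 0 < a₀' ∧ ∃ a k₀ : ℕ, 8 ≤ (ℓ + 1) ^ a ∧
    ∀ cL : ℝ, 0 < cL → cL * (((ℓ + 1 : ℕ) : ℝ)) ^ 2 < a₀' →
    ∃ B₁ B₂ c₁ : ℝ, 0 < B₁ ∧ 0 < B₂ ∧ 0 < c₁ ∧ ∀ (m K k : ℕ) (η : ℝ), 1 ≤ k → k + k₀ ≤ m + K → 0 < η →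
      (∀ (i : KIdx d ℓ hd hL 1 1) (n : ℕ), 1 ≤ n → n ≤ k → (∀ x, i.D.lev x = n) → i.k = n + 1 → i.Mh = (ℓ + 1) ^ a →
        i.cf = (((ℓ + 1 : ℕ) : ℝ)) ^ (n + 1) → (PV d ℓ i.m i.K hd hL).sitesPerDir 0 = (PV d ℓ m K hd hL).sitesPerDir 0 →
        ∀ ⦃α₀ : ℝ⦄, 0 < α₀ → α₀ ≤ cL → ∀ U₀ : LSite (d + 1) → Fin (d + 1) → (Matrix (Fin N) (Fin N) ℂ)ˣ,
          (∀ x κ, U₀ x κ ∈ specialUnitaryUnits (Fin N)) →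
          (∀ (x : LSite (d + 1)) (μ : Fin (d + 1)), U₀ (x + (((PV d ℓ m K hd hL).sitesPerDir 0 : ℕ) : ℤ) • e μ) = U₀ x) →
          InAk (ℓ + 1) n η α₀ (fun _ => (Set.univ : Set (LSite (d + 1)))) U₀ →
          ∃ (g : ↥(cubes (toKT i).D.toDomains) → GaugeY (Matrix (Fin N) (Fin N) ℂ) i)
            (A : ↥(cubes (toKT i).D.toDomains) → AfldY (Matrix (Fin N) (Fin N) ℂ) i)
            (Q : ↥(cubes (toKT i).D.toDomains) → Set (Site (PV d ℓ i.m i.K hd hL) 0))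
            (C ξ Λ : ↥(cubes (toKT i).D.toDomains) → ℝ),
            (∀ c x, ‖(g c x : Matrix (Fin N) (Fin N) ℂ)‖ ≤ 1 ∧ ‖(((g c x)⁻¹ : (Matrix (Fin N) (Fin N) ℂ)ˣ) : Matrix (Fin N) (Fin N) ℂ)‖ ≤ 1) ∧
            (∀ c, 0 ≤ C c) ∧ (∀ c, 0 < ξ c) ∧ (∀ c, 1 ≤ Λ c) ∧ (∀ c, ξ c ≤ 5 * (SC i c : ℝ) * (kGeo i).eta) ∧
            (∀ c, LatticeNorms.scaleLen ((ℓ : ℝ) + 1) (kGeo i).eta (c.1.1 + 1) ≤ Λ c * ξ c) ∧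
            (∀ c, ∀ x : Site (PV d ℓ i.m i.K hd hL) 0, NearC i c (35 * SC i c / 8 + 1) (boxEquiv i.hN x).1 → x ∈ Q c) ∧
            (∀ c, ∀ (κ : Fin (d + 1)) (x : Site (PV d ℓ i.m i.K hd hL) 0), x ∈ Q c → x.shift κ ∈ Q c →
              gaugeY i (g c) (bgY i U₀) κ x = fluct (kGeo i).eta (A c) κ x) ∧
            (∀ c, ∀ κ, ∀ x ∈ Q c, ‖A c κ x‖ ≤ C c * (ξ c)⁻¹) ∧
            (∀ c, ∀ μ ν, ∀ x ∈ Q c,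
              ‖(((kGeo i).eta : ℂ)⁻¹) • covD (shiftsV1 (PV d ℓ i.m i.K hd hL)) (fun _ _ => (1 : (Matrix (Fin N) (Fin N) ℂ)ˣ)) μ (A c ν) x‖ ≤
                C c * (ξ c ^ 2)⁻¹) ∧
            (∀ c, max (C c) (C c * (1 + D1 thetaProf)) * Λ c ^ 2 ≤ a₁) ∧ (∀ c, max (C c) (C c * (1 + D1 thetaProf)) * Λ c ^ 2 ≤ 1 / 4)) →
      (∀ m', m' ≤ k → ∀ ⦃α₀ : ℝ⦄, 0 < α₀ → α₀ ≤ cL → ∀ U₀ : LSite (d + 1) → Fin (d + 1) → (Matrix (Fin N) (Fin N) ℂ)ˣ,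
          (∀ x κ, U₀ x κ ∈ specialUnitaryUnits (Fin N)) →
          (∀ (x : LSite (d + 1)) (μ : Fin (d + 1)), U₀ (x + (((PV d ℓ m K hd hL).sitesPerDir 0 : ℕ) : ℤ) • e μ) = U₀ x) →
          InAk (ℓ + 1) m' η α₀ (fun _ => (Set.univ : Set (LSite (d + 1)))) U₀ →
          B9P3PerAt (𝔸 := Matrix (Fin N) (Fin N) ℂ) (ℓ + 1) B₀ B₀β cB9 βH len η m' α₀ (((PV d ℓ m K hd hL).sitesPerDir 0 : ℕ) : ℤ) U₀) →
      Thm2TorusAt (ℓ + 1) k ((((PV d ℓ m K hd hL).sitesPerDir 0 : ℕ) : ℤ)) η 0 B₁ B₂ c₁ len (specialUnitaryUnits (Fin N)) (fun _ => True) := by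
  letI : CStarAlgebra (Matrix (Fin N) (Fin N) ℂ) := {}
  have hB₁ : 5 * ((d + 1 : ℕ) : ℝ) * ((ℓ + 1 : ℕ) : ℝ) * B₀ * (1 + 11 * (((d + 1 : ℕ) : ℝ)) ^ 2)
      < 5 * ((d + 1 : ℕ) : ℝ) * ((ℓ + 1 : ℕ) : ℝ) * B₀ * (1 + 11 * (((d + 1 : ℕ) : ℝ)) ^ 2) + 1 := lt_add_one _
  have hB₁pos : 0 < 5 * ((d + 1 : ℕ) : ℝ) * ((ℓ + 1 : ℕ) : ℝ) * B₀ * (1 + 11 * (((d + 1 : ℕ) : ℝ)) ^ 2) + 1 := by positivity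
  obtain ⟨a₁, ha₁, a₀', ha₀', M₀, T₀, N₀, H⟩ :=
    thm2TorusAt_specialUnitary_ofCubeData' (hd := hd) (hL := hL) (b₀ := (1 : ℝ)) (b₁ := (1 : ℝ)) (len := len) (B₀β := B₀β) (βH := βH) hN hd2 (by omega)
      hB₀ hB hcB9 hB₁ b hM₂ hrepr Rr Hp
  -- G1: the catalogue against these thresholds
  obtain ⟨a, k₀, memF, ιBF, h8, hk₀, Hcat⟩ := exists_catalogueF16 (d := d) (hd := hd) (hL := hL) (b₀ := (1 : ℝ)) (b₁ := (1 : ℝ)) hℓ one_pos le_rfl M₀ T₀ N₀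
  refine ⟨a₁, ha₁, a₀', ha₀', a, k₀, h8, fun cL hcL hαe => ?_⟩
  obtain ⟨B₂, c₁, hB₂, hc₁, HT⟩ := H 1 memF ιBF cL hcL (by simpa using hαe)
  refine ⟨_, B₂, c₁, hB₁pos, hB₂, hc₁, fun m K k η hk hkK hη hdata hb9 => ?_⟩
  obtain ⟨hshape, hP, hlev, hcat⟩ := Hcat m K k hk hkK
  refine HT k _ η hk hη (pow_dvd_period (PV d ℓ m K hd hL) (j := 0) (by simpa using (show k ≤ m + K by omega))) hP hlev hcat ?_ hb9
  intro n hn hnk α₀ hα hαc U₀ hU₀G hU₀per hA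
  obtain ⟨hD, hkn, hMh, hcf, hper, -⟩ := hshape n hn hnk
  exact hdata _ n hn hnk hD hkn hMh hcf hper hα hαc U₀ hU₀G hU₀per hA

/-! ## §1′ ∕ §1 ★★★★★ [B8] Thm 2 (both currencies) from the per-cube (3.35) data and the FOUR Δ_a-side members at `M_h = L^{a′}` -/

/-- ★★★★★ **§1 IN PRINT's CURRENCY** (`Thm2TorusAt`, existence AND uniqueness): statement = §1 `thm2SetupSUAt_ofCubeData_deltaAFour_exists` below with the conclusion
`Thm2TorusAt L k P₀ η 0 B₁ B₂ c₁ len SU(N) ⊤`; proof = G3 §1's over §0, F10′ `sockB9P3Per_torus_allLevels_catalogued_four` and r05's `b9Arrow_of_sockB9P3Per`.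
HONEST SCOPE: (α), (Δa) displayed; `stub_PV3A` NOT discharged; the Yang–Mills mass gap is NOT proved.
[cite: Balaban1985RegularSpaces, Thm 2 p.83, (1.33)–(1.39) pp.82–83, p.77 («Ω_j = T_η»), p.76 («G = SU(N)»), (1.58)–(1.60) pp.86–87, Prop. 3 p.87; Balaban1985BackgroundPropagators, p.408 l.30–34 («R, M sufficiently large … powers of L»), (3.35)–(3.37) p.396, Thm 3.3 p.399, (3.69) p.404, Thm 3.11 p.416; Balaban1984PropagatorsII, (2.1)–(2.4) p.224; Balaban1985Averaging, (4) p.18, Prop. 2 p.26] -/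
theorem thm2TorusAtSU_ofCubeData_deltaAFour_exists (hN : N ≤ 25) (hd2 : 2 ≤ d + 1) (hℓ : 4 ≤ ℓ)
    (τ : Matrix (Fin N) (Fin N) ℂ →ₗ[ℂ] ℂ) (hτ : ∀ a, τ a = Matrix.trace a) (hτt : ∀ a b, τ (a * b) = τ (b * a))
    {Cτ : ℝ} (hCτ : ∀ x y : Matrix (Fin N) (Fin N) ℂ, |(τ (star x * y)).re| ≤ Cτ * ‖x‖ * ‖y‖)
    {M : ℝ} (hM1 : 1 ≤ M) {B₀ aT : ℝ} (hB₀ : 0 < B₀) (haT : 0 < aT) (haTQ : aT ≤ alphaQ (d + 1) (ℓ + 1) / ((ℓ + 1 : ℕ) : ℝ) ^ 2)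
    (haT3 : C0 (d + 1) * aT ≤ 1 / 3) (haT2 : 2 * aT ≤ c2' (d + 1) (ℓ + 1))
    (hεB : 2 * ((48 * ((d : ℝ) + 1) + 14 * d * M + (32 * ((d : ℝ) + 2) ^ 2 +
        12 * ((d : ℝ) + 1) ^ 2 * (13344 * ((d : ℝ) + 1) * ((d : ℝ) + 2) ^ 2 * ((d : ℝ) + 5) * (((ℓ + 1 : ℕ) : ℝ)) ^ (d + 4)) *
          (Cτ * (letI : CStarAlgebra (Matrix (Fin N) (Fin N) ℂ) := {}; betaTau τ)))) * aT) * B₀ ≤ 1)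
    {len : LSite (d + 1) → ℝ}
    {ι : Type} [Fintype ι] [DecidableEq ι] (b : Module.Basis ι ℝ (Matrix (Fin N) (Fin N) ℂ)) {M₂ : ℝ} (hM₂ : 0 ≤ M₂)
    (hrepr : ∀ (v : Matrix (Fin N) (Fin N) ℂ) (j : ι), |b.repr v j| ≤ M₂ * ‖v‖) (Rr : ℝ) (Hp : Prop) {a' : ℕ} (h8' : 8 ≤ (ℓ + 1) ^ a') :
    letI : CStarAlgebra (Matrix (Fin N) (Fin N) ℂ) := {}
    ∃ a₁ : ℝ, 0 < a₁ ∧ ∃ a₀' : ℝ, 0 < a₀' ∧ ∃ a k₀ : ℕ, 8 ≤ (ℓ + 1) ^ a ∧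
    ∀ cL : ℝ, 0 < cL → cL * (((ℓ + 1 : ℕ) : ℝ)) ^ 2 < a₀' →
      cL ≤ min (1 / 16) (min aT (min aT (1 / (2 * (2 * B₀) * (14 * ((d + 1 - 1 : ℕ) : ℝ)) * M + 1)))) →
    ∃ B₁ B₂ c₁ : ℝ, 0 < B₁ ∧ 0 < B₂ ∧ 0 < c₁ ∧ ∀ (m K k : ℕ) (η : ℝ), 1 ≤ k → k + k₀ ≤ m + K → 0 < η →
      (∀ (i : KIdx d ℓ hd hL 1 1) (n : ℕ), 1 ≤ n → n ≤ k → (∀ x, i.D.lev x = n) → i.k = n + 1 → i.Mh = (ℓ + 1) ^ a →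
        i.cf = (((ℓ + 1 : ℕ) : ℝ)) ^ (n + 1) → (PV d ℓ i.m i.K hd hL).sitesPerDir 0 = (PV d ℓ m K hd hL).sitesPerDir 0 →
        ∀ ⦃α₀ : ℝ⦄, 0 < α₀ → α₀ ≤ cL → ∀ U₀ : LSite (d + 1) → Fin (d + 1) → (Matrix (Fin N) (Fin N) ℂ)ˣ,
          (∀ x κ, U₀ x κ ∈ specialUnitaryUnits (Fin N)) →
          (∀ (x : LSite (d + 1)) (μ : Fin (d + 1)), U₀ (x + (((PV d ℓ m K hd hL).sitesPerDir 0 : ℕ) : ℤ) • e μ) = U₀ x) →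
          InAk (ℓ + 1) n η α₀ (fun _ => (Set.univ : Set (LSite (d + 1)))) U₀ →
          ∃ (g : ↥(cubes (toKT i).D.toDomains) → GaugeY (Matrix (Fin N) (Fin N) ℂ) i)
            (A : ↥(cubes (toKT i).D.toDomains) → AfldY (Matrix (Fin N) (Fin N) ℂ) i)
            (Q : ↥(cubes (toKT i).D.toDomains) → Set (Site (PV d ℓ i.m i.K hd hL) 0))
            (C ξ Λ : ↥(cubes (toKT i).D.toDomains) → ℝ),
            (∀ c x, ‖(g c x : Matrix (Fin N) (Fin N) ℂ)‖ ≤ 1 ∧ ‖(((g c x)⁻¹ : (Matrix (Fin N) (Fin N) ℂ)ˣ) : Matrix (Fin N) (Fin N) ℂ)‖ ≤ 1) ∧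
            (∀ c, 0 ≤ C c) ∧ (∀ c, 0 < ξ c) ∧ (∀ c, 1 ≤ Λ c) ∧ (∀ c, ξ c ≤ 5 * (SC i c : ℝ) * (kGeo i).eta) ∧
            (∀ c, LatticeNorms.scaleLen ((ℓ : ℝ) + 1) (kGeo i).eta (c.1.1 + 1) ≤ Λ c * ξ c) ∧
            (∀ c, ∀ x : Site (PV d ℓ i.m i.K hd hL) 0, NearC i c (35 * SC i c / 8 + 1) (boxEquiv i.hN x).1 → x ∈ Q c) ∧
            (∀ c, ∀ (κ : Fin (d + 1)) (x : Site (PV d ℓ i.m i.K hd hL) 0), x ∈ Q c → x.shift κ ∈ Q c →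
              gaugeY i (g c) (bgY i U₀) κ x = fluct (kGeo i).eta (A c) κ x) ∧
            (∀ c, ∀ κ, ∀ x ∈ Q c, ‖A c κ x‖ ≤ C c * (ξ c)⁻¹) ∧
            (∀ c, ∀ μ ν, ∀ x ∈ Q c,
              ‖(((kGeo i).eta : ℂ)⁻¹) • covD (shiftsV1 (PV d ℓ i.m i.K hd hL)) (fun _ _ => (1 : (Matrix (Fin N) (Fin N) ℂ)ˣ)) μ (A c ν) x‖ ≤
                C c * (ξ c ^ 2)⁻¹) ∧
            (∀ c, max (C c) (C c * (1 + D1 thetaProf)) * Λ c ^ 2 ≤ a₁) ∧ (∀ c, max (C c) (C c * (1 + D1 thetaProf)) * Λ c ^ 2 ≤ 1 / 4)) →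
      (∀ (i : KIdx d ℓ hd hL 1 1) (m' : ℕ), 1 ≤ m' → m' ≤ k → i.k = m' + 1 → (∀ x, i.D.lev x = m') → i.Mh = (ℓ + 1) ^ a' →
        i.cf = (((ℓ + 1 : ℕ) : ℝ)) ^ (m' + 1) →
        (∀ ι : IBondY i, i.w ι = i.cf ^ 2 * (((((ℓ + 1 : ℕ) : ℝ)) ^ (ι.1.1 : ℕ)) ^ (d + 1) * (1 / (((ℓ + 1 : ℕ) : ℝ)) ^ (ι.1.1 : ℕ)) ^ 2)) →
        (PV d ℓ i.m i.K hd hL).sitesPerDir 0 = (PV d ℓ m K hd hL).sitesPerDir 0 →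
        ∀ (α₀ : ℝ) (U₀ : LSite (d + 1) → Fin (d + 1) → (Matrix (Fin N) (Fin N) ℂ)ˣ),
        (∀ x κ, U₀ x κ ∈ B7Prop2Explicit.unitaryUnits (Matrix (Fin N) (Fin N) ℂ)) →
        IsPeriodic ((PV d ℓ m K hd hL).sitesPerDir 0) U₀ → 0 < α₀ → α₀ ≤ aT →
        InAk (ℓ + 1) m' η α₀ (fun _ => (Set.univ : Set (LSite (d + 1)))) U₀ →
          IsUnit (deltaAY i (parKnitY i) (parBY i) (GpY i (parKnitY i)) (bgY i U₀)) ∧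
          (∀ F, wNormBY i (-1) (GAY i (parKnitY i) (parBY i) (GpY i (parKnitY i)) (bgY i U₀) F) ≤ B₀ * wNormBY i (-3) F) ∧
          (∀ F ν, wNormBY i (-2) (cdB i (bgY i U₀) ν (GAY i (parKnitY i) (parBY i) (GpY i (parKnitY i)) (bgY i U₀) F)) ≤ B₀ * wNormBY i (-3) F) ∧
          (∀ F, wNormBY i (-3) (lapB i (bgY i U₀) (GAY i (parKnitY i) (parBY i) (GpY i (parKnitY i)) (bgY i U₀) F)) ≤ B₀ * wNormBY i (-3) F)) →
      Thm2TorusAt (ℓ + 1) k ((((PV d ℓ m K hd hL).sitesPerDir 0 : ℕ) : ℤ)) η 0 B₁ B₂ c₁ len (specialUnitaryUnits (Fin N)) (fun _ => True) := by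
  letI : CStarAlgebra (Matrix (Fin N) (Fin N) ℂ) := {}
  have hL1 : 1 ≤ ℓ + 1 := by omega
  -- the (B)-line constants served by F10's socket
  set Bs : ℝ := max (max 1 (2 * (2 * B₀) * max 1 (qQ (d + 1) (ℓ + 1) Cτ (betaTau τ) 0))) (max 2 (4 * ((d + 1 : ℕ) : ℝ))) with hBs
  set Cs : ℝ := max (2 * max 0 (2 * (2 * B₀)) * max 1 (qQ (d + 1) (ℓ + 1) Cτ (betaTau τ) 0)) 4 with hCs
  set cP : ℝ := min (1 / 16) (min aT (min aT (1 / (2 * (2 * B₀) * (14 * ((d + 1 - 1 : ℕ) : ℝ)) * M + 1)))) with hcP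
  have hBs2 : 2 ≤ Bs := (le_max_left _ _).trans (le_max_right _ _)
  have hBs0 : 0 < Bs := lt_of_lt_of_le two_pos hBs2
  have hBs' : 2 ≤ 5 * ((d + 1 : ℕ) : ℝ) * ((ℓ + 1 : ℕ) : ℝ) * Bs := by
    have h1 : (1 : ℝ) ≤ ((d + 1 : ℕ) : ℝ) := by exact_mod_cast Nat.succ_le_succ (Nat.zero_le d)
    have h2 : (1 : ℝ) ≤ ((ℓ + 1 : ℕ) : ℝ) := by exact_mod_cast hL1
    have h3 : (2 : ℝ) ≤ ((d + 1 : ℕ) : ℝ) * ((ℓ + 1 : ℕ) : ℝ) * Bs := by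
      have := mul_le_mul (mul_le_mul h1 h2 zero_le_one (zero_le_one.trans h1)) hBs2 zero_le_two (by positivity)
      simpa using this
    nlinarith
  have hcP0 : 0 < cP := by
    have hM0 : 0 < 2 * (2 * B₀) * (14 * ((d + 1 - 1 : ℕ) : ℝ)) * M + 1 := by
      have : 0 ≤ 2 * (2 * B₀) * (14 * ((d + 1 - 1 : ℕ) : ℝ)) * M := by
        have := hB₀.le; have : (0 : ℝ) ≤ M := le_trans zero_le_one hM1; positivity
      linarith
    refine lt_min (by norm_num) (lt_min haT (lt_min haT (div_pos one_pos hM0)))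
  -- §0 (G2 in the `Thm2TorusAt` currency) at these constants
  obtain ⟨a₁, ha₁, a₀', ha₀', a, k₀, h8, H⟩ :=
    thm2TorusAtSU_ofCubeData_catalogued_exists (hd := hd) (hL := hL) (len := len) (B₀β := Cs) (βH := (0 : ℝ)) hN hd2 hℓ hBs0 hBs'
      hcP0 b hM₂ hrepr Rr Hp
  refine ⟨a₁, ha₁, a₀', ha₀', a, max k₀ (a' + 3), h8, fun cL hcL hαe hcLP => ?_⟩
  obtain ⟨B₁, B₂, c₁, hB₁, hB₂, hc₁, HT⟩ := H cL hcL hαe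
  refine ⟨B₁, B₂, c₁, hB₁, hB₂, hc₁, fun m K k η hk hkK hη hdata hΔ => HT m K k η hk (by omega) hη hdata ?_⟩
  -- the (B)-lines from the FOUR Δ_a-side members at `M_h = L^{a′}`: F10′'s socket at all truncations `m′ ≤ k`, then r05's guarded arrow at radius `c_L ≤ c_P`
  let ops₀ : ℝ → ZdIdx (d + 1) (ℓ + 1) → ℕ → OpsZd (d + 1) (Matrix (Fin N) (Fin N) ℂ) :=
    fun _ _ _ => ⟨fun _ A => A, fun _ A => A, fun _ A => A, fun _ A => A⟩
  have hS := sockB9P3Per_torus_allLevels_catalogued_four (hd := hd) (hL := hL) hℓ hd2 hL1 τ hτ hτt hCτ (m := m) (K := K) (K' := k) (a := a') h8'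
    (by omega) hη (k := 1) le_rfl ops₀ hM1 hB₀ haT haTQ haT3 haT2 hεB hΔ len
  exact b9Arrow_of_sockB9P3Per (cB := cP) (cL := cL) hS le_rfl hcLP

/-- ★★★★★ **G3 §1 ON F10′: [B8] THM 2 AT THE `SU(N)`-VALUED SETUP-TORUS OBJECTS OF EVERY `PV d ℓ m K` WITH `k + k₀ ≤ m + K`, FROM (α) THE PER-CUBE (3.35) DATA
AND (Δa) THE FOUR Δ_a-SIDE MEMBERS AT BIG BLOCKS `M_h = L^{a′}`** (`1 ≤ N ≤ 25`, `d + 1 ≥ 2`, odd `L = ℓ + 1 ≥ 5`; `τ = tr` with `C_τ`; `B₀ > 0`, `M ≥ 1`, `a_T`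
in the windows with F7's numeric condition; `len`; basis `b`, `M₂`; `Rr, Hp`; the consumer's exponent `a′` with `L^{a′} ≥ 8`).  Statement = G3
`thm2SetupSUAt_ofCubeData_deltaASide_exists` VERBATIM except: the located threshold is `max k₀ (a′ + 3)` and (Δa) := F10′'s binder at `K′ = k` — at every
shape-member `i` of constant level `1 ≤ m′ ≤ k` WITH `i.Mh = L^{a′}` and every admissible background: `IsUnit Δ_a` and the three weighted bounds of `G_a` at `B₀`
(members (5)(6) are theorems: Thm 3.11 p. 416 «obvious for the first three operators»).  HONEST SCOPE: (α), (Δa) displayed; `stub_PV3A` NOT discharged; the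
Yang–Mills mass gap is NOT proved.
[cite: Balaban1985RegularSpaces, Thm 2 p.83, (1.33)–(1.39) pp.82–83, p.77 («Ω_j = T_η»), p.76 («G = SU(N)»), (1.58)–(1.60) pp.86–87, Prop. 3 p.87; Balaban1985BackgroundPropagators, p.408 l.30–34 («R, M sufficiently large … powers of L»), (3.35)–(3.37) p.396, Thm 3.1 (3.42) p.397, Thm 3.2 (3.48) p.398, Thm 3.3 p.399, Thm 3.4 p.400, (3.16) p.393, (3.41) p.397, (3.69) p.404, Thm 3.7 pp.409–410, Thm 3.9 p.413, Thm 3.11 p.416; Balaban1984PropagatorsII, (2.1)–(2.4) p.224, (2.16) p.225, Lemma 2.1 pp.233–234; Balaban1985Averaging, (4) p.18, Prop. 2 p.26] -/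
theorem thm2SetupSUAt_ofCubeData_deltaAFour_exists (hN : N ≤ 25) (hd2 : 2 ≤ d + 1) (hℓ : 4 ≤ ℓ)
    (τ : Matrix (Fin N) (Fin N) ℂ →ₗ[ℂ] ℂ) (hτ : ∀ a, τ a = Matrix.trace a) (hτt : ∀ a b, τ (a * b) = τ (b * a))
    {Cτ : ℝ} (hCτ : ∀ x y : Matrix (Fin N) (Fin N) ℂ, |(τ (star x * y)).re| ≤ Cτ * ‖x‖ * ‖y‖)
    {M : ℝ} (hM1 : 1 ≤ M) {B₀ aT : ℝ} (hB₀ : 0 < B₀) (haT : 0 < aT) (haTQ : aT ≤ alphaQ (d + 1) (ℓ + 1) / ((ℓ + 1 : ℕ) : ℝ) ^ 2)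
    (haT3 : C0 (d + 1) * aT ≤ 1 / 3) (haT2 : 2 * aT ≤ c2' (d + 1) (ℓ + 1))
    (hεB : 2 * ((48 * ((d : ℝ) + 1) + 14 * d * M + (32 * ((d : ℝ) + 2) ^ 2 +
        12 * ((d : ℝ) + 1) ^ 2 * (13344 * ((d : ℝ) + 1) * ((d : ℝ) + 2) ^ 2 * ((d : ℝ) + 5) * (((ℓ + 1 : ℕ) : ℝ)) ^ (d + 4)) *
          (Cτ * (letI : CStarAlgebra (Matrix (Fin N) (Fin N) ℂ) := {}; betaTau τ)))) * aT) * B₀ ≤ 1)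
    {len : LSite (d + 1) → ℝ}
    {ι : Type} [Fintype ι] [DecidableEq ι] (b : Module.Basis ι ℝ (Matrix (Fin N) (Fin N) ℂ)) {M₂ : ℝ} (hM₂ : 0 ≤ M₂)
    (hrepr : ∀ (v : Matrix (Fin N) (Fin N) ℂ) (j : ι), |b.repr v j| ≤ M₂ * ‖v‖) (Rr : ℝ) (Hp : Prop) {a' : ℕ} (h8' : 8 ≤ (ℓ + 1) ^ a') :
    letI : CStarAlgebra (Matrix (Fin N) (Fin N) ℂ) := {}
    ∃ a₁ : ℝ, 0 < a₁ ∧ ∃ a₀' : ℝ, 0 < a₀' ∧ ∃ a k₀ : ℕ, 8 ≤ (ℓ + 1) ^ a ∧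
    ∀ cL : ℝ, 0 < cL → cL * (((ℓ + 1 : ℕ) : ℝ)) ^ 2 < a₀' →
      cL ≤ min (1 / 16) (min aT (min aT (1 / (2 * (2 * B₀) * (14 * ((d + 1 - 1 : ℕ) : ℝ)) * M + 1)))) →
    ∃ B₁ B₂ c₁ : ℝ, 0 < B₁ ∧ 0 < B₂ ∧ 0 < c₁ ∧ ∀ (m K k : ℕ) (η : ℝ), 1 ≤ k → k + k₀ ≤ m + K → 0 < η →
      (∀ (i : KIdx d ℓ hd hL 1 1) (n : ℕ), 1 ≤ n → n ≤ k → (∀ x, i.D.lev x = n) → i.k = n + 1 → i.Mh = (ℓ + 1) ^ a →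
        i.cf = (((ℓ + 1 : ℕ) : ℝ)) ^ (n + 1) → (PV d ℓ i.m i.K hd hL).sitesPerDir 0 = (PV d ℓ m K hd hL).sitesPerDir 0 →
        ∀ ⦃α₀ : ℝ⦄, 0 < α₀ → α₀ ≤ cL → ∀ U₀ : LSite (d + 1) → Fin (d + 1) → (Matrix (Fin N) (Fin N) ℂ)ˣ,
          (∀ x κ, U₀ x κ ∈ specialUnitaryUnits (Fin N)) →
          (∀ (x : LSite (d + 1)) (μ : Fin (d + 1)), U₀ (x + (((PV d ℓ m K hd hL).sitesPerDir 0 : ℕ) : ℤ) • e μ) = U₀ x) →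
          InAk (ℓ + 1) n η α₀ (fun _ => (Set.univ : Set (LSite (d + 1)))) U₀ →
          ∃ (g : ↥(cubes (toKT i).D.toDomains) → GaugeY (Matrix (Fin N) (Fin N) ℂ) i)
            (A : ↥(cubes (toKT i).D.toDomains) → AfldY (Matrix (Fin N) (Fin N) ℂ) i)
            (Q : ↥(cubes (toKT i).D.toDomains) → Set (Site (PV d ℓ i.m i.K hd hL) 0))
            (C ξ Λ : ↥(cubes (toKT i).D.toDomains) → ℝ),
            (∀ c x, ‖(g c x : Matrix (Fin N) (Fin N) ℂ)‖ ≤ 1 ∧ ‖(((g c x)⁻¹ : (Matrix (Fin N) (Fin N) ℂ)ˣ) : Matrix (Fin N) (Fin N) ℂ)‖ ≤ 1) ∧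
            (∀ c, 0 ≤ C c) ∧ (∀ c, 0 < ξ c) ∧ (∀ c, 1 ≤ Λ c) ∧ (∀ c, ξ c ≤ 5 * (SC i c : ℝ) * (kGeo i).eta) ∧
            (∀ c, LatticeNorms.scaleLen ((ℓ : ℝ) + 1) (kGeo i).eta (c.1.1 + 1) ≤ Λ c * ξ c) ∧
            (∀ c, ∀ x : Site (PV d ℓ i.m i.K hd hL) 0, NearC i c (35 * SC i c / 8 + 1) (boxEquiv i.hN x).1 → x ∈ Q c) ∧
            (∀ c, ∀ (κ : Fin (d + 1)) (x : Site (PV d ℓ i.m i.K hd hL) 0), x ∈ Q c → x.shift κ ∈ Q c →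
              gaugeY i (g c) (bgY i U₀) κ x = fluct (kGeo i).eta (A c) κ x) ∧
            (∀ c, ∀ κ, ∀ x ∈ Q c, ‖A c κ x‖ ≤ C c * (ξ c)⁻¹) ∧
            (∀ c, ∀ μ ν, ∀ x ∈ Q c,
              ‖(((kGeo i).eta : ℂ)⁻¹) • covD (shiftsV1 (PV d ℓ i.m i.K hd hL)) (fun _ _ => (1 : (Matrix (Fin N) (Fin N) ℂ)ˣ)) μ (A c ν) x‖ ≤
                C c * (ξ c ^ 2)⁻¹) ∧
            (∀ c, max (C c) (C c * (1 + D1 thetaProf)) * Λ c ^ 2 ≤ a₁) ∧ (∀ c, max (C c) (C c * (1 + D1 thetaProf)) * Λ c ^ 2 ≤ 1 / 4)) →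
      (∀ (i : KIdx d ℓ hd hL 1 1) (m' : ℕ), 1 ≤ m' → m' ≤ k → i.k = m' + 1 → (∀ x, i.D.lev x = m') → i.Mh = (ℓ + 1) ^ a' →
        i.cf = (((ℓ + 1 : ℕ) : ℝ)) ^ (m' + 1) →
        (∀ ι : IBondY i, i.w ι = i.cf ^ 2 * (((((ℓ + 1 : ℕ) : ℝ)) ^ (ι.1.1 : ℕ)) ^ (d + 1) * (1 / (((ℓ + 1 : ℕ) : ℝ)) ^ (ι.1.1 : ℕ)) ^ 2)) →
        (PV d ℓ i.m i.K hd hL).sitesPerDir 0 = (PV d ℓ m K hd hL).sitesPerDir 0 →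
        ∀ (α₀ : ℝ) (U₀ : LSite (d + 1) → Fin (d + 1) → (Matrix (Fin N) (Fin N) ℂ)ˣ),
        (∀ x κ, U₀ x κ ∈ B7Prop2Explicit.unitaryUnits (Matrix (Fin N) (Fin N) ℂ)) →
        IsPeriodic ((PV d ℓ m K hd hL).sitesPerDir 0) U₀ → 0 < α₀ → α₀ ≤ aT →
        InAk (ℓ + 1) m' η α₀ (fun _ => (Set.univ : Set (LSite (d + 1)))) U₀ →
          IsUnit (deltaAY i (parKnitY i) (parBY i) (GpY i (parKnitY i)) (bgY i U₀)) ∧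
          (∀ F, wNormBY i (-1) (GAY i (parKnitY i) (parBY i) (GpY i (parKnitY i)) (bgY i U₀) F) ≤ B₀ * wNormBY i (-3) F) ∧
          (∀ F ν, wNormBY i (-2) (cdB i (bgY i U₀) ν (GAY i (parKnitY i) (parBY i) (GpY i (parKnitY i)) (bgY i U₀) F)) ≤ B₀ * wNormBY i (-3) F) ∧
          (∀ F, wNormBY i (-3) (lapB i (bgY i U₀) (GAY i (parKnitY i) (parBY i) (GpY i (parKnitY i)) (bgY i U₀) F)) ≤ B₀ * wNormBY i (-3) F)) →
      Thm2SetupSUAt (PV d ℓ m K hd hL) N k η 0 B₁ B₂ c₁ len (fun _ => True) := by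
  letI : CStarAlgebra (Matrix (Fin N) (Fin N) ℂ) := {}
  obtain ⟨a₁, ha₁, a₀', ha₀', a, k₀, h8, H⟩ :=
    thm2TorusAtSU_ofCubeData_deltaAFour_exists (hd := hd) (hL := hL) (len := len) hN hd2 hℓ τ hτ hτt hCτ hM1 hB₀ haT haTQ haT3 haT2 hεB b hM₂
      hrepr Rr Hp h8'
  refine ⟨a₁, ha₁, a₀', ha₀', a, k₀, h8, fun cL hcL hαe hcLP => ?_⟩
  obtain ⟨B₁, B₂, c₁, hB₁, hB₂, hc₁, HT⟩ := H cL hcL hαe hcLP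
  exact ⟨B₁, B₂, c₁, hB₁, hB₂, hc₁, fun m K k η hk hkK hη hdata hΔ => thm2SetupSUAt_of_thm2TorusAt (HT m K k η hk hkK hη hdata hΔ)⟩

/-! ## §2′ ∕ §2 ★★★★★ [B8] Thm 2 (both currencies), (3.35) dropped by Prop. 6: modulo the FOUR Δ_a-side members at `M_h = L^{a′}` -/

/-- ★★★★★ **§2 IN PRINT's CURRENCY** (`Thm2TorusAt`, existence AND uniqueness): statement = §2 `thm2SetupSUAt_ofProp6_deltaAFour_exists` below with the conclusion
`Thm2TorusAt L k P₀ η 0 B₁ B₂ c₁ len SU(N) ⊤`; proof = G5 §2's over §1′ (G5 §1 `reg335Cube_ball_of_prop6At`, G4 `cubeDatum_of_reg335Zd`, pub-ymgap's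
`prop6At_bgZd_allTorus_holds` BY NAME).  This is the statement pub-ymgap's period reduction `thm2TorusAt_of_dvd` reads at the cover period for the members below
the located volume threshold (LF-2VOL), `(B₁, c₁)` being bound before `(m, K)`.  HONEST SCOPE: (Δa) displayed, inhabited by nothing here; `stub_PV3A` NOT
discharged; the Yang–Mills mass gap is NOT proved.
[cite: Balaban1985RegularSpaces, Thm 2 p.83, (1.33)–(1.39) pp.82–83, p.82 («eventually we will drop it out of the assumptions»), Prop. 6 p.99, p.77 («Ω_j = T_η»), p.76 («G = SU(N)»), (1.58)–(1.60) pp.86–87; Balaban1985BackgroundPropagators, p.408 l.30–34, (3.35)–(3.37) p.396, Thm 3.3 p.399, Thm 3.4 p.400, (3.69) p.404, Thm 3.11 p.416; Balaban1984PropagatorsII, (2.1)–(2.4) p.224, Lemma 2.1 pp.233–234; Balaban1985Averaging, (4) p.18, Prop. 2 p.26; Balaban1985UV3, (1)–(3) p.256] -/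
theorem thm2TorusAtSU_ofProp6_deltaAFour_exists (hN : N ≤ 25) (hd2 : 2 ≤ d + 1) (hℓ : 4 ≤ ℓ)
    (τ : Matrix (Fin N) (Fin N) ℂ →ₗ[ℂ] ℂ) (hτ : ∀ a, τ a = Matrix.trace a) (hτt : ∀ a b, τ (a * b) = τ (b * a))
    {Cτ : ℝ} (hCτ : ∀ x y : Matrix (Fin N) (Fin N) ℂ, |(τ (star x * y)).re| ≤ Cτ * ‖x‖ * ‖y‖)
    {M : ℝ} (hM1 : 1 ≤ M) {B₀ aT : ℝ} (hB₀ : 0 < B₀) (haT : 0 < aT) (haTQ : aT ≤ alphaQ (d + 1) (ℓ + 1) / ((ℓ + 1 : ℕ) : ℝ) ^ 2)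
    (haT3 : C0 (d + 1) * aT ≤ 1 / 3) (haT2 : 2 * aT ≤ c2' (d + 1) (ℓ + 1))
    (hεB : 2 * ((48 * ((d : ℝ) + 1) + 14 * d * M + (32 * ((d : ℝ) + 2) ^ 2 +
        12 * ((d : ℝ) + 1) ^ 2 * (13344 * ((d : ℝ) + 1) * ((d : ℝ) + 2) ^ 2 * ((d : ℝ) + 5) * (((ℓ + 1 : ℕ) : ℝ)) ^ (d + 4)) *
          (Cτ * (letI : CStarAlgebra (Matrix (Fin N) (Fin N) ℂ) := {}; betaTau τ)))) * aT) * B₀ ≤ 1)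
    {len : LSite (d + 1) → ℝ}
    {ι : Type} [Fintype ι] [DecidableEq ι] (b : Module.Basis ι ℝ (Matrix (Fin N) (Fin N) ℂ)) {M₂ : ℝ} (hM₂ : 0 ≤ M₂)
    (hrepr : ∀ (v : Matrix (Fin N) (Fin N) ℂ) (j : ι), |b.repr v j| ≤ M₂ * ‖v‖) (Rr : ℝ) (Hp : Prop) {a' : ℕ} (h8' : 8 ≤ (ℓ + 1) ^ a') :
    letI : CStarAlgebra (Matrix (Fin N) (Fin N) ℂ) := {}
    ∃ a₀' : ℝ, 0 < a₀' ∧ ∃ k₀ : ℕ, ∃ cα : ℝ, 0 < cα ∧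
    ∀ cL : ℝ, 0 < cL → cL * (((ℓ + 1 : ℕ) : ℝ)) ^ 2 < a₀' →
      cL ≤ min (1 / 16) (min aT (min aT (1 / (2 * (2 * B₀) * (14 * ((d + 1 - 1 : ℕ) : ℝ)) * M + 1)))) → cL ≤ cα →
    ∃ B₁ B₂ c₁ : ℝ, 0 < B₁ ∧ 0 < B₂ ∧ 0 < c₁ ∧ ∀ (m K k : ℕ) (η : ℝ), 1 ≤ k → k + k₀ ≤ m + K → 0 < η →
      (∀ (i : KIdx d ℓ hd hL 1 1) (m' : ℕ), 1 ≤ m' → m' ≤ k → i.k = m' + 1 → (∀ x, i.D.lev x = m') → i.Mh = (ℓ + 1) ^ a' →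
        i.cf = (((ℓ + 1 : ℕ) : ℝ)) ^ (m' + 1) →
        (∀ ι : IBondY i, i.w ι = i.cf ^ 2 * (((((ℓ + 1 : ℕ) : ℝ)) ^ (ι.1.1 : ℕ)) ^ (d + 1) * (1 / (((ℓ + 1 : ℕ) : ℝ)) ^ (ι.1.1 : ℕ)) ^ 2)) →
        (PV d ℓ i.m i.K hd hL).sitesPerDir 0 = (PV d ℓ m K hd hL).sitesPerDir 0 →
        ∀ (α₀ : ℝ) (U₀ : LSite (d + 1) → Fin (d + 1) → (Matrix (Fin N) (Fin N) ℂ)ˣ),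
        (∀ x κ, U₀ x κ ∈ B7Prop2Explicit.unitaryUnits (Matrix (Fin N) (Fin N) ℂ)) →
        IsPeriodic ((PV d ℓ m K hd hL).sitesPerDir 0) U₀ → 0 < α₀ → α₀ ≤ aT →
        InAk (ℓ + 1) m' η α₀ (fun _ => (Set.univ : Set (LSite (d + 1)))) U₀ →
          IsUnit (deltaAY i (parKnitY i) (parBY i) (GpY i (parKnitY i)) (bgY i U₀)) ∧
          (∀ F, wNormBY i (-1) (GAY i (parKnitY i) (parBY i) (GpY i (parKnitY i)) (bgY i U₀) F) ≤ B₀ * wNormBY i (-3) F) ∧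
          (∀ F ν, wNormBY i (-2) (cdB i (bgY i U₀) ν (GAY i (parKnitY i) (parBY i) (GpY i (parKnitY i)) (bgY i U₀) F)) ≤ B₀ * wNormBY i (-3) F) ∧
          (∀ F, wNormBY i (-3) (lapB i (bgY i U₀) (GAY i (parKnitY i) (parBY i) (GpY i (parKnitY i)) (bgY i U₀) F)) ≤ B₀ * wNormBY i (-3) F)) →
      Thm2TorusAt (ℓ + 1) k ((((PV d ℓ m K hd hL).sitesPerDir 0 : ℕ) : ℤ)) η 0 B₁ B₂ c₁ len (specialUnitaryUnits (Fin N)) (fun _ => True) := by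
  letI : CStarAlgebra (Matrix (Fin N) (Fin N) ℂ) := {}
  haveI : Nonempty (Fin N) := ⟨⟨0, Nat.pos_of_ne_zero (NeZero.ne N)⟩⟩
  -- [B8] Prop. 6 at the all-torus members (pub-ymgap, unconditional)
  obtain ⟨c35, c₆, K₆, hc35, hc₆, hK₆, hP6⟩ :=
    prop6At_bgZd_allTorus_holds (𝔸 := Matrix (Fin N) (Fin N) ℂ) (d := d + 1) hd2 (L := ℓ + 1) (by omega) hL.1
  -- §1′
  obtain ⟨a₁, ha₁, a₀', ha₀', a, k₀, h8, H⟩ :=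
    thm2TorusAtSU_ofCubeData_deltaAFour_exists (hd := hd) (hL := hL) (len := len) hN hd2 hℓ τ hτ hτt hCτ hM1 hB₀ haT haTQ haT3 haT2 hεB b hM₂ hrepr
      Rr Hp h8'
  -- the smallness threshold for Prop. 6 at `M_h = L^a`: `MP = 10·L·L^a`
  set Lr : ℝ := ((ℓ + 1 : ℕ) : ℝ) with hLr
  set MP : ℝ := ((10 * (ℓ + 1) * (ℓ + 1) ^ a : ℕ) : ℝ) with hMP
  have hMP0 : 0 < MP := by rw [hMP]; positivity
  set D : ℝ := max 1 (1 + D1 thetaProf) with hD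
  have hD1 : 1 ≤ D := le_max_left _ _
  have hD0 : 0 < D := lt_of_lt_of_le one_pos hD1
  set cα : ℝ := min (c₆ / MP) (min a₁ (1 / 4) / (c35 * MP * K₆ * Lr ^ 2 * D + 1)) with hcα
  have hden : 0 < c35 * MP * K₆ * Lr ^ 2 * D + 1 := by positivity
  have hcα0 : 0 < cα := lt_min (div_pos hc₆ hMP0) (div_pos (lt_min ha₁ (by norm_num)) hden)
  refine ⟨a₀', ha₀', k₀, cα, hcα0, fun cL hcL hαe hcLP hcLα => ?_⟩
  obtain ⟨B₁, B₂, c₁, hB₁, hB₂, hc₁, HT⟩ := H cL hcL hαe hcLP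
  refine ⟨B₁, B₂, c₁, hB₁, hB₂, hc₁, fun m K k η hk hkK hη hΔ => HT m K k η hk hkK hη ?_ hΔ⟩
  -- (α): the per-cube (3.35) data from Prop. 6 through the carrier bridge G4
  intro i n hn hnk hD hkn hMh hcf hper α₀ hα₀ hα₀c U₀ hU₀G hU₀per hAk
  have hU₀ : ∀ x κ, U₀ x κ ∈ unitaryUnits (Matrix (Fin N) (Fin N) ℂ) := fun x κ => specialUnitaryUnits_le_unitaryUnits (hU₀G x κ)
  -- periodicity in the member's own period letter
  have hU₀per' : ∀ (x : LSite (d + 1)) (μ : Fin (d + 1)), U₀ (x + (((PV d ℓ i.m i.K hd hL).sitesPerDir 0 : ℕ) : ℤ) • e μ) = U₀ x := by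
    rw [hper]; exact hU₀per
  have hα₀α : α₀ ≤ cα := hα₀c.trans hcLα
  -- per cube
  have hcube : ∀ c : ↥(cubes (toKT i).D.toDomains),
      ∃ (g : GaugeY (Matrix (Fin N) (Fin N) ℂ) i) (A : AfldY (Matrix (Fin N) (Fin N) ℂ) i) (Q : Set (Site (PV d ℓ i.m i.K hd hL) 0)) (C ξ Λ : ℝ),
      (∀ x, ‖(g x : Matrix (Fin N) (Fin N) ℂ)‖ ≤ 1 ∧ ‖(((g x)⁻¹ : (Matrix (Fin N) (Fin N) ℂ)ˣ) : Matrix (Fin N) (Fin N) ℂ)‖ ≤ 1) ∧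
      0 ≤ C ∧ 0 < ξ ∧ 1 ≤ Λ ∧ ξ ≤ 5 * (SC i c : ℝ) * (kGeo i).eta ∧
      LatticeNorms.scaleLen ((ℓ : ℝ) + 1) (kGeo i).eta (c.1.1 + 1) ≤ Λ * ξ ∧
      (∀ x : Site (PV d ℓ i.m i.K hd hL) 0, NearC i c (35 * SC i c / 8 + 1) (boxEquiv i.hN x).1 → x ∈ Q) ∧
      (∀ (κ : Fin (d + 1)) (x : Site (PV d ℓ i.m i.K hd hL) 0), x ∈ Q → x.shift κ ∈ Q →
        gaugeY i g (bgY i U₀) κ x = fluct (kGeo i).eta A κ x) ∧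
      (∀ κ, ∀ x ∈ Q, ‖A κ x‖ ≤ C * ξ⁻¹) ∧
      (∀ μ ν, ∀ x ∈ Q,
        ‖(((kGeo i).eta : ℂ)⁻¹) • covD (shiftsV1 (PV d ℓ i.m i.K hd hL)) (fun _ _ => (1 : (Matrix (Fin N) (Fin N) ℂ)ˣ)) μ (A ν) x‖ ≤ C * (ξ ^ 2)⁻¹) ∧
      max C (C * (1 + D1 thetaProf)) * Λ ^ 2 ≤ a₁ ∧ max C (C * (1 + D1 thetaProf)) * Λ ^ 2 ≤ 1 / 4 := by
    intro c
    -- the cube's level is the member's constant level `n`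
    have hjn : c.1.1 = n := by
      obtain ⟨x, _, hx⟩ := Finset.mem_image.1 c.2
      have h1 : c.1.1 = (toKT i).D.lev x := (congrArg Prod.fst hx).symm
      rw [h1]; exact hD x
    -- Prop. 6's datum on the aligned cube containing the chart ball
    have hMhℕ : (toKT i).Mh = (ℓ + 1) ^ a := hMh
    have hsmall : ((10 * (ℓ + 1) * (toKT i).Mh : ℕ) : ℝ) * α₀ ≤ c₆ := by
      rw [hMhℕ, ← hMP]
      have h1 : α₀ ≤ c₆ / MP := hα₀α.trans (min_le_left _ _)
      rw [le_div_iff₀ hMP0] at h1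
      linarith
    have hAj : InAk (ℓ + 1) c.1.1 η α₀ (fun _ => (Set.univ : Set (LSite (d + 1)))) U₀ := by rw [hjn]; exact hAk
    obtain ⟨B, hB, h335⟩ := reg335Cube_ball_of_prop6At (hd := hd) (hL := hL) hP6 i c hη hα₀ hsmall hU₀ hAj
    -- the constant `C_Z = c35 · MP · K₆ · α₀`
    set CZ : ℝ := c35 * ((10 * (ℓ + 1) * (toKT i).Mh : ℕ) : ℝ) * (K₆ * α₀) with hCZ
    have hCZ' : CZ = c35 * MP * K₆ * α₀ := by rw [hCZ, hMhℕ, ← hMP]; ring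
    have hCZ0 : 0 ≤ CZ := by rw [hCZ']; positivity
    -- the (3.37) sizes from `α₀ ≤ c_α`
    have hkey : CZ * Lr ^ 2 * D ≤ min a₁ (1 / 4) := by
      have h1 : α₀ ≤ min a₁ (1 / 4) / (c35 * MP * K₆ * Lr ^ 2 * D + 1) := hα₀α.trans (min_le_right _ _)
      rw [le_div_iff₀ hden] at h1
      have h2 : CZ * Lr ^ 2 * D = α₀ * (c35 * MP * K₆ * Lr ^ 2 * D) := by rw [hCZ']; ring
      rw [h2]
      nlinarith [hα₀.le]
    have hmax : max (CZ * Lr ^ 2) (CZ * Lr ^ 2 * (1 + D1 thetaProf)) ≤ CZ * Lr ^ 2 * D := by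
      refine max_le ?_ ?_
      · have : CZ * Lr ^ 2 * 1 ≤ CZ * Lr ^ 2 * D := mul_le_mul_of_nonneg_left hD1 (by positivity)
        linarith
      · exact mul_le_mul_of_nonneg_left (le_max_right _ _) (by positivity)
    have hsz₁ : max (CZ * Lr ^ 2) (CZ * Lr ^ 2 * (1 + D1 thetaProf)) ≤ a₁ := hmax.trans (hkey.trans (min_le_left _ _))
    have hsz₄ : max (CZ * Lr ^ 2) (CZ * Lr ^ 2 * (1 + D1 thetaProf)) ≤ 1 / 4 := hmax.trans (hkey.trans (min_le_right _ _))
    -- the room inequality: `N = M_h·L^{k+1}·P′ ≥ 25 S_n`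
    have hroom : (35 * SC i c / 8 + 3) * 2 ≤ (((PV d ℓ i.m i.K hd hL).sitesPerDir 0 : ℕ) : ℤ) := by
      have hSC9 := nine_le_SC i c
      have hNB : B6MultiLevelBoxOperator.N0 ℓ i.Mh i.k i.P' 0 = (PV d ℓ i.m i.K hd hL).sitesPerDir 0 := i.hN 0
      have hP5 : 5 ≤ i.P' 0 := i.hP5 0
      have h25 : 5 * 5 ≤ (ℓ + 1) * i.P' 0 := Nat.mul_le_mul (by omega) hP5
      have hNnat : 25 * (i.Mh * (ℓ + 1) ^ (n + 1)) ≤ B6MultiLevelBoxOperator.N0 ℓ i.Mh i.k i.P' 0 := by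
        show 25 * (i.Mh * (ℓ + 1) ^ (n + 1)) ≤ (ℓ + 1) ^ i.k * ((ℓ + 1) * (i.Mh * i.P' 0))
        rw [hkn]
        calc 25 * (i.Mh * (ℓ + 1) ^ (n + 1)) ≤ ((ℓ + 1) * i.P' 0) * (i.Mh * (ℓ + 1) ^ (n + 1)) := Nat.mul_le_mul_right _ h25
          _ = (ℓ + 1) ^ (n + 1) * ((ℓ + 1) * (i.Mh * i.P' 0)) := by ring
      rw [hNB] at hNnat
      have hSC : SC i c = ((i.Mh * (ℓ + 1) ^ (n + 1) : ℕ) : ℤ) := by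
        show ((B6MultiLevelBoxOperator.bigSide ℓ (toKT i).Mh c.1.1 : ℕ) : ℤ) = _
        rw [hjn]; rfl
      have hN' : ((25 * (i.Mh * (ℓ + 1) ^ (n + 1)) : ℕ) : ℤ) ≤ (((PV d ℓ i.m i.K hd hL).sitesPerDir 0 : ℕ) : ℤ) := Int.ofNat_le.mpr hNnat
      rw [Nat.cast_mul, ← hSC] at hN'
      omega
    exact cubeDatum_of_reg335Zd i c hU₀per' hη hCZ0 hsz₁ hsz₄ hroom hB h335
  choose g A Q C ξ Λ hg hC hξ hΛ hξS hΛξ hQ hgA hAb hdA hs₁ hs₄ using hcube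
  exact ⟨g, A, Q, C, ξ, Λ, fun c x => hg c x, hC, hξ, hΛ, hξS, hΛξ, hQ, hgA, hAb, hdA, hs₁, hs₄⟩

/-- ★★★★★ **G5 §2 ON F10′: [B8] THM 2 AT THE `SU(N)`-VALUED SETUP-TORUS OBJECTS OF EVERY `PV d ℓ m K` WITH `k + k₀ ≤ m + K`, FROM THE FOUR Δ_a-SIDE MEMBERS AT
BIG BLOCKS `M_h = L^{a′}` ALONE — (3.35) DROPPED by Proposition 6** (inputs as G5 §2 plus the consumer's exponent `a′`, `L^{a′} ≥ 8`).  `∃ a₀′ > 0, ∃ k₀, ∃ c_α > 0,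
∀ c_L > 0` with `c_L·L² < a₀′`, `c_L ≤ c_P`, `c_L ≤ c_α`, `∃ B₁ B₂ c₁ > 0, ∀ m K k η` (`1 ≤ k`, `k + k₀ ≤ m + K`, `η > 0`): (Δa) [F10′'s binder at `K′ = k`: at
every shape-member `i : KIdx d ℓ hd hL 1 1` of constant level `1 ≤ m′ ≤ k` WITH `i.Mh = L^{a′}`, every `0 < α₀ ≤ a_T`, every `U(N)`-valued `P₀`-periodic
`U₀ ∈ 𝔄_{m′}(T_η, α₀)`: `IsUnit Δ_a` and the three weighted bounds of `G_a` at `B₀`] → `Thm2SetupSUAt (PV d ℓ m K hd hL) N k η 0 B₁ B₂ c₁ len (fun _ => True)`.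
Proof = G5 §2's, over §1 (G5 §1 `reg335Cube_ball_of_prop6At`, G4 `cubeDatum_of_reg335Zd`, pub-ymgap's `prop6At_bgZd_allTorus_holds` BY NAME).  HONEST SCOPE:
(Δa) displayed, inhabited by nothing here; `stub_PV3A` NOT discharged; the Yang–Mills mass gap is NOT proved.
[cite: Balaban1985RegularSpaces, Thm 2 p.83, (1.33)–(1.39) pp.82–83, p.82 («eventually we will drop it out of the assumptions»), Prop. 6 p.99, p.77 («Ω_j = T_η»), p.76 («G = SU(N)»), (1.58)–(1.60) pp.86–87; Balaban1985BackgroundPropagators, p.408 l.30–34 («R, M sufficiently large … powers of L»), (3.35)–(3.37) p.396, Thm 3.1 p.397, Thm 3.2 p.398, Thm 3.3 p.399, Thm 3.4 p.400, Thm 3.11 p.416; Balaban1984PropagatorsII, (2.1)–(2.4) p.224, Lemma 2.1 pp.233–234; Balaban1985Averaging, (4) p.18, Prop. 2 p.26] -/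
theorem thm2SetupSUAt_ofProp6_deltaAFour_exists (hN : N ≤ 25) (hd2 : 2 ≤ d + 1) (hℓ : 4 ≤ ℓ)
    (τ : Matrix (Fin N) (Fin N) ℂ →ₗ[ℂ] ℂ) (hτ : ∀ a, τ a = Matrix.trace a) (hτt : ∀ a b, τ (a * b) = τ (b * a))
    {Cτ : ℝ} (hCτ : ∀ x y : Matrix (Fin N) (Fin N) ℂ, |(τ (star x * y)).re| ≤ Cτ * ‖x‖ * ‖y‖)
    {M : ℝ} (hM1 : 1 ≤ M) {B₀ aT : ℝ} (hB₀ : 0 < B₀) (haT : 0 < aT) (haTQ : aT ≤ alphaQ (d + 1) (ℓ + 1) / ((ℓ + 1 : ℕ) : ℝ) ^ 2)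
    (haT3 : C0 (d + 1) * aT ≤ 1 / 3) (haT2 : 2 * aT ≤ c2' (d + 1) (ℓ + 1))
    (hεB : 2 * ((48 * ((d : ℝ) + 1) + 14 * d * M + (32 * ((d : ℝ) + 2) ^ 2 +
        12 * ((d : ℝ) + 1) ^ 2 * (13344 * ((d : ℝ) + 1) * ((d : ℝ) + 2) ^ 2 * ((d : ℝ) + 5) * (((ℓ + 1 : ℕ) : ℝ)) ^ (d + 4)) *
          (Cτ * (letI : CStarAlgebra (Matrix (Fin N) (Fin N) ℂ) := {}; betaTau τ)))) * aT) * B₀ ≤ 1)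
    {len : LSite (d + 1) → ℝ}
    {ι : Type} [Fintype ι] [DecidableEq ι] (b : Module.Basis ι ℝ (Matrix (Fin N) (Fin N) ℂ)) {M₂ : ℝ} (hM₂ : 0 ≤ M₂)
    (hrepr : ∀ (v : Matrix (Fin N) (Fin N) ℂ) (j : ι), |b.repr v j| ≤ M₂ * ‖v‖) (Rr : ℝ) (Hp : Prop) {a' : ℕ} (h8' : 8 ≤ (ℓ + 1) ^ a') :
    letI : CStarAlgebra (Matrix (Fin N) (Fin N) ℂ) := {}
    ∃ a₀' : ℝ, 0 < a₀' ∧ ∃ k₀ : ℕ, ∃ cα : ℝ, 0 < cα ∧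
    ∀ cL : ℝ, 0 < cL → cL * (((ℓ + 1 : ℕ) : ℝ)) ^ 2 < a₀' →
      cL ≤ min (1 / 16) (min aT (min aT (1 / (2 * (2 * B₀) * (14 * ((d + 1 - 1 : ℕ) : ℝ)) * M + 1)))) → cL ≤ cα →
    ∃ B₁ B₂ c₁ : ℝ, 0 < B₁ ∧ 0 < B₂ ∧ 0 < c₁ ∧ ∀ (m K k : ℕ) (η : ℝ), 1 ≤ k → k + k₀ ≤ m + K → 0 < η →
      (∀ (i : KIdx d ℓ hd hL 1 1) (m' : ℕ), 1 ≤ m' → m' ≤ k → i.k = m' + 1 → (∀ x, i.D.lev x = m') → i.Mh = (ℓ + 1) ^ a' →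
        i.cf = (((ℓ + 1 : ℕ) : ℝ)) ^ (m' + 1) →
        (∀ ι : IBondY i, i.w ι = i.cf ^ 2 * (((((ℓ + 1 : ℕ) : ℝ)) ^ (ι.1.1 : ℕ)) ^ (d + 1) * (1 / (((ℓ + 1 : ℕ) : ℝ)) ^ (ι.1.1 : ℕ)) ^ 2)) →
        (PV d ℓ i.m i.K hd hL).sitesPerDir 0 = (PV d ℓ m K hd hL).sitesPerDir 0 →
        ∀ (α₀ : ℝ) (U₀ : LSite (d + 1) → Fin (d + 1) → (Matrix (Fin N) (Fin N) ℂ)ˣ),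
        (∀ x κ, U₀ x κ ∈ B7Prop2Explicit.unitaryUnits (Matrix (Fin N) (Fin N) ℂ)) →
        IsPeriodic ((PV d ℓ m K hd hL).sitesPerDir 0) U₀ → 0 < α₀ → α₀ ≤ aT →
        InAk (ℓ + 1) m' η α₀ (fun _ => (Set.univ : Set (LSite (d + 1)))) U₀ →
          IsUnit (deltaAY i (parKnitY i) (parBY i) (GpY i (parKnitY i)) (bgY i U₀)) ∧
          (∀ F, wNormBY i (-1) (GAY i (parKnitY i) (parBY i) (GpY i (parKnitY i)) (bgY i U₀) F) ≤ B₀ * wNormBY i (-3) F) ∧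
          (∀ F ν, wNormBY i (-2) (cdB i (bgY i U₀) ν (GAY i (parKnitY i) (parBY i) (GpY i (parKnitY i)) (bgY i U₀) F)) ≤ B₀ * wNormBY i (-3) F) ∧
          (∀ F, wNormBY i (-3) (lapB i (bgY i U₀) (GAY i (parKnitY i) (parBY i) (GpY i (parKnitY i)) (bgY i U₀) F)) ≤ B₀ * wNormBY i (-3) F)) →
      Thm2SetupSUAt (PV d ℓ m K hd hL) N k η 0 B₁ B₂ c₁ len (fun _ => True) := by
  letI : CStarAlgebra (Matrix (Fin N) (Fin N) ℂ) := {}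
  obtain ⟨a₀', ha₀', k₀, cα, hcα, H⟩ :=
    thm2TorusAtSU_ofProp6_deltaAFour_exists (hd := hd) (hL := hL) (len := len) hN hd2 hℓ τ hτ hτt hCτ hM1 hB₀ haT haTQ haT3 haT2 hεB b hM₂ hrepr
      Rr Hp h8'
  refine ⟨a₀', ha₀', k₀, cα, hcα, fun cL hcL hαe hcLP hcLα => ?_⟩
  obtain ⟨B₁, B₂, c₁, hB₁, hB₂, hc₁, HT⟩ := H cL hcL hαe hcLP hcLα
  exact ⟨B₁, B₂, c₁, hB₁, hB₂, hc₁, fun m K k η hk hkK hη hΔ => thm2SetupSUAt_of_thm2TorusAt (HT m K k η hk hkK hη hΔ)⟩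

end Setup

/-! ## §3 ★★★★★ The `hThm2` binder of the 19200 dictionary (`d + 1 = 3`, `N = 2`), (3.35) dropped, FOUR Δ_a-side members at `M_h = L^{a′}` -/

section Binder

variable {hd₃ : 1 ≤ 2 + 1}
variable [instF : ∀ i : KIdx 2 ℓ hd₃ hL 1 1, Fintype (geo9K i).Site] [instD : ∀ i : KIdx 2 ℓ hd₃ hL 1 1, DecidableEq (geo9K i).Site]

/-- ★★★★★ **G5 §3 ON F10′: THE `hThm2` BINDER OF THE 19200 DICTIONARY FROM THE FOUR Δ_a-SIDE MEMBERS AT BIG BLOCKS `M_h = L^{a′}` ALONE, FOR THE FAMILIES WITH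
`k₀ ≤ F.m + n`** (§2 at `d + 1 = 3`, `N = 2`, read at `(m, K, k, η) := (F.m, K, K − n, L^{−(K−n)})` through `F.P K = PV 2 ℓ F.m K`; the consumer's exponent `a′`,
`L^{a′} ≥ 8`): `… ∃ B₁ B₂ c₁ > 0, ∀ F : T3Family`, `F.L = ℓ + 1` → `∀ n < K`, `k₀ ≤ F.m + n` → (Δa) → `∃ β₀ B₂′ len′, Thm2SetupSUAt (F.P K) 2 (K − n) (eta F n K) β₀
B₁ B₂′ c₁ len′ (fun _ => True)` — the hypothesis of `Prop7SPrintThm2Dict.prop2Printed_sPrint_of_thm2SetupSUAt` for those families, modulo (Δa).  HONEST SCOPE as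
§2; `stub_PV3A` NOT discharged; the Yang–Mills mass gap is NOT proved.
[cite: Balaban1985RegularSpaces, Thm 2 p.83, (1.33)–(1.39) pp.82–83, Prop. 6 p.99, p.77 («Ω_j = T_η»), p.76; Balaban1985BackgroundPropagators, p.408 l.30–34 («R, M sufficiently large … powers of L»), (3.35)–(3.37) p.396, Thm 3.3 p.399, Thm 3.4 p.400, Thm 3.11 p.416; Balaban1985UV3, (1)–(3) p.256; Balaban1984PropagatorsII, (2.1)–(2.4) p.224] -/
theorem hThm2_of_prop6_deltaAFour (hℓ : 4 ≤ ℓ)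
    (τ : Matrix (Fin 2) (Fin 2) ℂ →ₗ[ℂ] ℂ) (hτ : ∀ a, τ a = Matrix.trace a) (hτt : ∀ a b, τ (a * b) = τ (b * a))
    {Cτ : ℝ} (hCτ : ∀ x y : Matrix (Fin 2) (Fin 2) ℂ, |(τ (star x * y)).re| ≤ Cτ * ‖x‖ * ‖y‖)
    {M : ℝ} (hM1 : 1 ≤ M) {B₀ aT : ℝ} (hB₀ : 0 < B₀) (haT : 0 < aT) (haTQ : aT ≤ alphaQ (2 + 1) (ℓ + 1) / ((ℓ + 1 : ℕ) : ℝ) ^ 2)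
    (haT3 : C0 (2 + 1) * aT ≤ 1 / 3) (haT2 : 2 * aT ≤ c2' (2 + 1) (ℓ + 1))
    (hεB : 2 * ((48 * (((2 : ℕ) : ℝ) + 1) + 14 * ((2 : ℕ) : ℝ) * M + (32 * (((2 : ℕ) : ℝ) + 2) ^ 2 +
        12 * (((2 : ℕ) : ℝ) + 1) ^ 2 * (13344 * (((2 : ℕ) : ℝ) + 1) * (((2 : ℕ) : ℝ) + 2) ^ 2 * (((2 : ℕ) : ℝ) + 5) * (((ℓ + 1 : ℕ) : ℝ)) ^ (2 + 4)) *
          (Cτ * (letI : CStarAlgebra (Matrix (Fin 2) (Fin 2) ℂ) := {}; betaTau τ)))) * aT) * B₀ ≤ 1)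
    {len : LSite (2 + 1) → ℝ}
    {ι : Type} [Fintype ι] [DecidableEq ι] (b : Module.Basis ι ℝ (Matrix (Fin 2) (Fin 2) ℂ)) {M₂ : ℝ} (hM₂ : 0 ≤ M₂)
    (hrepr : ∀ (v : Matrix (Fin 2) (Fin 2) ℂ) (j : ι), |b.repr v j| ≤ M₂ * ‖v‖) (Rr : ℝ) (Hp : Prop) {a' : ℕ} (h8' : 8 ≤ (ℓ + 1) ^ a') :
    letI : CStarAlgebra (Matrix (Fin 2) (Fin 2) ℂ) := {}
    ∃ a₀' : ℝ, 0 < a₀' ∧ ∃ k₀ : ℕ, ∃ cα : ℝ, 0 < cα ∧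
    ∀ cL : ℝ, 0 < cL → cL * (((ℓ + 1 : ℕ) : ℝ)) ^ 2 < a₀' →
      cL ≤ min (1 / 16) (min aT (min aT (1 / (2 * (2 * B₀) * (14 * ((2 + 1 - 1 : ℕ) : ℝ)) * M + 1)))) → cL ≤ cα →
    ∃ B₁ B₂ c₁ : ℝ, 0 < B₁ ∧ 0 < B₂ ∧ 0 < c₁ ∧
    ∀ F : T3Family, F.L = ℓ + 1 → ∀ (n K : ℕ), n < K → k₀ ≤ F.m + n →
      (∀ (i : KIdx 2 ℓ hd₃ hL 1 1) (m' : ℕ), 1 ≤ m' → m' ≤ K - n → i.k = m' + 1 → (∀ x, i.D.lev x = m') → i.Mh = (ℓ + 1) ^ a' →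
        i.cf = (((ℓ + 1 : ℕ) : ℝ)) ^ (m' + 1) →
        (∀ ι : IBondY i, i.w ι = i.cf ^ 2 * (((((ℓ + 1 : ℕ) : ℝ)) ^ (ι.1.1 : ℕ)) ^ (2 + 1) * (1 / (((ℓ + 1 : ℕ) : ℝ)) ^ (ι.1.1 : ℕ)) ^ 2)) →
        (PV 2 ℓ i.m i.K hd₃ hL).sitesPerDir 0 = (PV 2 ℓ F.m K hd₃ hL).sitesPerDir 0 →
        ∀ (α₀ : ℝ) (U₀ : LSite (2 + 1) → Fin (2 + 1) → (Matrix (Fin 2) (Fin 2) ℂ)ˣ),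
        (∀ x κ, U₀ x κ ∈ B7Prop2Explicit.unitaryUnits (Matrix (Fin 2) (Fin 2) ℂ)) →
        IsPeriodic ((PV 2 ℓ F.m K hd₃ hL).sitesPerDir 0) U₀ → 0 < α₀ → α₀ ≤ aT →
        InAk (ℓ + 1) m' (eta F n K) α₀ (fun _ => (Set.univ : Set (LSite (2 + 1)))) U₀ →
          IsUnit (deltaAY i (parKnitY i) (parBY i) (GpY i (parKnitY i)) (bgY i U₀)) ∧
          (∀ F', wNormBY i (-1) (GAY i (parKnitY i) (parBY i) (GpY i (parKnitY i)) (bgY i U₀) F') ≤ B₀ * wNormBY i (-3) F') ∧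
          (∀ F' ν, wNormBY i (-2) (cdB i (bgY i U₀) ν (GAY i (parKnitY i) (parBY i) (GpY i (parKnitY i)) (bgY i U₀) F')) ≤ B₀ * wNormBY i (-3) F') ∧
          (∀ F', wNormBY i (-3) (lapB i (bgY i U₀) (GAY i (parKnitY i) (parBY i) (GpY i (parKnitY i)) (bgY i U₀) F')) ≤ B₀ * wNormBY i (-3) F')) →
      ∃ (β₀ B₂' : ℝ) (len' : LSite (F.P K).d → ℝ),
        Thm2SetupSUAt (F.P K) 2 (K - n) (eta F n K) β₀ B₁ B₂' c₁ len' (fun _ => True) := by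
  letI : CStarAlgebra (Matrix (Fin 2) (Fin 2) ℂ) := {}
  obtain ⟨a₀', ha₀', k₀, cα, hcα, H⟩ :=
    thm2SetupSUAt_ofProp6_deltaAFour_exists (d := 2) (hd := hd₃) (hL := hL) (len := len) (by norm_num) (by norm_num) hℓ τ hτ hτt hCτ hM1 hB₀
      haT haTQ haT3 haT2 hεB b hM₂ hrepr Rr Hp h8'
  refine ⟨a₀', ha₀', k₀, cα, hcα, fun cL hcL hαe hcLP hcLα => ?_⟩
  obtain ⟨B₁, B₂, c₁, hB₁, hB₂, hc₁, HT⟩ := H cL hcL hαe hcLP hcLα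
  refine ⟨B₁, B₂, c₁, hB₁, hB₂, hc₁, fun F hF n K hnK hm hΔ => ?_⟩
  have hT : Thm2SetupSUAt (PV 2 ℓ F.m K hd₃ hL) 2 (K - n) (eta F n K) 0 B₁ B₂ c₁ len (fun _ => True) :=
    HT F.m K (K - n) (eta F n K) (by omega) (by omega) (eta_pos F n K) hΔ
  rw [P_eq_PV (hd := hd₃) (hL := hL) F hF K]
  exact ⟨0, B₂, len, hT⟩
end Binder

/-! ## §4 ★ Every requested big-block size is a power of `L` away -/

/-- print's «M sufficiently large … We take these numbers as powers of L» is always available to the consumer of §1–§3: for every requested size `M₁` there is an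
exponent `a′` with `8 ≤ L^{a′}` and `M₁ ≤ L^{a′}` (`L = ℓ + 1 ≥ 2`). [cite: Balaban1985BackgroundPropagators, p.408 l.30–34] -/
theorem exists_exponent_ge (hℓ : 1 ≤ ℓ) (M₁ : ℕ) : ∃ a' : ℕ, 8 ≤ (ℓ + 1) ^ a' ∧ M₁ ≤ (ℓ + 1) ^ a' := by
  refine ⟨M₁ + 3, ?_, ?_⟩
  · calc (8 : ℕ) = 2 ^ 3 := by norm_num
      _ ≤ (ℓ + 1) ^ 3 := Nat.pow_le_pow_left (by omega) 3
      _ ≤ (ℓ + 1) ^ (M₁ + 3) := Nat.pow_le_pow_right (by omega) (by omega)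
  · calc M₁ ≤ 2 ^ M₁ := Nat.lt_two_pow_self.le
      _ ≤ (ℓ + 1) ^ M₁ := Nat.pow_le_pow_left (by omega) M₁
      _ ≤ (ℓ + 1) ^ (M₁ + 3) := Nat.pow_le_pow_right (by omega) (by omega)

end Literature.MathematicalPhysics.QuantumFieldTheory.Balaban1983to89.B8Thm2TorusOfProp6DeltaAFour

end
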